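import Summits.QuantumFields.YangMills.Theorems.AllWindowsColdBoxBoxHighLineEdgeChartSupport
import Summits.QuantumFields.YangMills.Theorems.AllWindowsColdBoxBoxHighLineChartHaarWeight
import Summits.QuantumFields.YangMills.Theorems.AllWindowsColdBoxBoxHighLineBoxQuadFormFloor
import Summits.QuantumFields.YangMills.Theorems.AllWindowsColdBoxBoxHighLineBoxStateEdgeChart
import Summits.QuantumFields.YangMills.Theorems.AllWindowsColdBoxBoxHighLineJacWeight

/-!
# T-S5.6 input: the POINTWISE sandwich of the Faddeev–Popov chart weight on small fields (given an action sandwich of relative error `ε`)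
# (STUB-PLAN-S5-STEP2 §5 T-S5.6 `SmallFieldInsideFP`; LINE-19 S5 ⟨stmt-QuantumFields-24004⟩/⟨24335⟩, LINE-20 U5 ⟨24336⟩; objects from ✓`…Step2Defs` BY NAME)

Width seat `ym-line-sfw-p2-w4` (prover-ym-line-sfw-p2-w4-g27-0), T-S5.6 holder.  On `smallField H t` the integrand
`fpChartWeight β H r a = χ_r(U_a)·e^{−β(boxWilson + landauPhi)(U_a)}·|det F(U_a)|·chartHaarWeight a` (`U_a = edgeChart H a`) is squeezed between Gaussians
`e^{−β(1±ε)·boxQuadForm H a}` times the determinant, once an ACTION SANDWICH `|boxWilson + landauPhi − boxQuadForm| ≤ ε·boxQuadForm` holds on `smallField H t`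
(the conclusion shape of T-S5.6a `ActionSandwich` with `ε = C·t·H`, taken here as a HYPOTHESIS at level `t`):
* `fpChartWeight_nonneg`, `measurable_fpChartWeight` (hygiene: ✓`continuous_ballCutoff`, ✓`continuous_exp_boxWilson`, ✓`continuous_landauPhi`,
  ✓`continuous_fpOperator_det`, ✓`EdgeChart.measurable_edgeChart`, ✓`EdgeChart.measurable_chartHaarWeight`);
* `linkDefect_edgeChart_le` (`linkDefect (U_a) e ≤ ‖a e‖²` on the chart domain, ✓4j upper half) and **`ballCutoff_edgeChart_eq_one`** (`χ_r(U_a) = 1` on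
  `smallField H t`, `t ≤ min(r, π)`);
* **`fpChartWeight_le_of_sandwich`** — `fpChartWeight β H r a ≤ |det F(U_a)|·((2π²)⁻¹)^n·e^{−β(1−ε)Q(a)}` on `smallField H t`;
* **`le_fpChartWeight_of_sandwich`** — `|det F(U_a)|·((2π²)⁻¹)^n·e^{−n(t²/3+t⁴)}·e^{−β(1+ε)Q(a)} ≤ fpChartWeight β H r a` on `smallField H t` (`t ≤ min(r, 1)`).
With ✓`ChartGauss.setIntegral_compl_smallField_exp_le` / ✓`le_setIntegral_smallField_exp` / ✓`integral_exp_neg_mul_boxQuadForm_eq_mul` (6d), ✓`EdgeChart.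
fpChartWeight_eq_zero_of_not_smallField` (support) and a determinant ratio on `smallField H (πr)` (6b, w2's 4r world), the T-S5.6 assembly is bookkeeping.

Everything proved; no definitions; standard axioms.  HONEST LABEL: an input of the OPEN task T-S5.6 of STEP 2 of the XL stub S5 of a critic-PASSed DRAFT line on the
R2ξ″ cruxes; T-S5.6, S5, U5 and the items ⟨24004⟩ ⟨24335⟩ ⟨24336⟩ remain OPEN; no stub is closed by name, no crux, rung or summit is proved; the Yang–Mills
mass gap is NOT proved by this file.
-/

set_option autoImplicit false

open MeasureTheory Real Finset
open Literature.MathematicalPhysics.QuantumFieldTheory.AxialGauge (boxEdges)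
open Literature.MathematicalPhysics.QuantumFieldTheory.LatticeMaxwell (boxEdgesAt)

namespace Summit.QuantumFields.YangMills.Theorems.AllWindowsColdBoxBoxHighLine

namespace FPChart

variable {H : ℕ}

/-! ## Hygiene -/

/-- The Faddeev–Popov chart weight is non-negative. -/
theorem fpChartWeight_nonneg (β : ℝ) (r : ℝ) (a : LandauFree H → E3) : 0 ≤ fpChartWeight β H r a := by
  unfold fpChartWeight
  exact mul_nonneg (mul_nonneg (mul_nonneg (ballCutoff_nonneg H r _) (Real.exp_pos _).le) (abs_nonneg _))
    (ChartHaar.chartHaarWeight_nonneg a)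

/-- The Faddeev–Popov chart weight is measurable. -/
theorem measurable_fpChartWeight (β : ℝ) (H : ℕ) (r : ℝ) : Measurable (fpChartWeight β H r) := by
  have hU : Measurable (edgeChart H) := EdgeChart.measurable_edgeChart H
  have h1 : Measurable fun a : LandauFree H → E3 => ballCutoff H r (edgeChart H a) :=
    (continuous_ballCutoff H r).measurable.comp hU
  have hW : Continuous (boxWilson H) :=
    Literature.MathematicalPhysics.QuantumLattice.continuous_wilsonBoundaryAction
      (Literature.MathematicalPhysics.QuantumLattice.fundamentalRep (Fin 2))
      (Literature.MathematicalPhysics.QuantumLattice.continuous_fundamentalRep (Fin 2)) (boxEdges 4 (2 * H + 1))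
  have h2 : Measurable fun a : LandauFree H → E3 =>
      Real.exp (-(β * (boxWilson H (edgeChart H a) + landauPhi H (edgeChart H a)))) :=
    ((Real.continuous_exp.comp ((continuous_const.mul (hW.add (continuous_landauPhi H))).neg)).measurable).comp hU
  have h3 : Measurable fun a : LandauFree H → E3 => |(fpOperator H (edgeChart H a)).det| :=
    ((continuous_fpOperator_det H).measurable.comp hU).abs
  have h4 : Measurable (chartHaarWeight H) := EdgeChart.measurable_chartHaarWeight H
  exact ((h1.mul h2).mul h3).mul h4

/-! ## The cut-off is `1` on small fields -/

/-- On the chart domain the link defect of the edge chart is at most `‖a e‖²` (✓4j upper half `‖q(e^{iA}) − 1‖ ≤ ‖A‖`). -/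
theorem linkDefect_edgeChart_le (a : LandauFree H → E3) (e : LandauFree H) (hπ : ‖a e‖ ≤ Real.pi) :
    linkDefect (edgeChart H a) e.1.1 ≤ ‖a e‖ ^ 2 := by
  rw [LandauBall.linkDefect_eq_norm_sq, EdgeChart.edgeChart_apply_free]
  exact pow_le_pow_left₀ (norm_nonneg _) (pauliChartComparison (a e) hπ).2 2

/-- **`χ_r(edgeChart a) = 1` on `smallField H t`** for `0 ≤ t ≤ r`, `t ≤ π`, `r ≠ 0`. -/
theorem ballCutoff_edgeChart_eq_one {r t : ℝ} (hr : r ≠ 0) (ht0 : 0 ≤ t) (htr : t ≤ r) (htπ : t ≤ Real.pi)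
    {a : LandauFree H → E3} (ha : a ∈ smallField H t) : ballCutoff H r (edgeChart H a) = 1 := by
  refine ballCutoff_eq_one hr fun E hE => ?_
  let e : LandauFree H := ⟨⟨E, mem_boxEdgesAt_of_mem_boxEdges hE⟩, not_not_intro hE⟩
  have h := linkDefect_edgeChart_le a e ((ha e).trans htπ)
  calc linkDefect (edgeChart H a) E = linkDefect (edgeChart H a) e.1.1 := rfl
    _ ≤ ‖a e‖ ^ 2 := h
    _ ≤ t ^ 2 := pow_le_pow_left₀ (norm_nonneg _) (ha e) 2
    _ ≤ r ^ 2 := pow_le_pow_left₀ ht0 htr 2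

/-! ## The pointwise sandwich -/

/-- **UPPER bound**: given the action sandwich `|W + Φ − Q| ≤ εQ` on `smallField H t`, for `β ≥ 0` and `a ∈ smallField H t`:
`fpChartWeight β H r a ≤ |det F(U_a)| · ((2π²)⁻¹)^{|LandauFree H|} · e^{−β(1−ε)Q(a)}`. -/
theorem fpChartWeight_le_of_sandwich {β t ε : ℝ} (hβ : 0 ≤ β)
    (hsand : ∀ a : LandauFree H → E3, (∀ e, ‖a e‖ ≤ t) →
      |boxWilson H (edgeChart H a) + landauPhi H (edgeChart H a) - boxQuadForm H a| ≤ ε * boxQuadForm H a)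
    (r : ℝ) {a : LandauFree H → E3} (ha : a ∈ smallField H t) :
    fpChartWeight β H r a ≤ |(fpOperator H (edgeChart H a)).det| * (1 / (2 * Real.pi ^ 2)) ^ Fintype.card (LandauFree H) *
      Real.exp (-(β * (1 - ε) * boxQuadForm H a)) := by
  have hWΦ : (1 - ε) * boxQuadForm H a ≤ boxWilson H (edgeChart H a) + landauPhi H (edgeChart H a) := by
    have h := (abs_le.1 (hsand a ha)).1
    linarith
  have h1 : ballCutoff H r (edgeChart H a) ≤ 1 := ballCutoff_le_one H r _
  have h0 : 0 ≤ ballCutoff H r (edgeChart H a) := ballCutoff_nonneg H r _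
  have h2 : Real.exp (-(β * (boxWilson H (edgeChart H a) + landauPhi H (edgeChart H a)))) ≤
      Real.exp (-(β * (1 - ε) * boxQuadForm H a)) :=
    Real.exp_le_exp.2 (by nlinarith [mul_le_mul_of_nonneg_left hWΦ hβ])
  have h3 := ChartHaar.chartHaarWeight_le a
  have h3' := ChartHaar.chartHaarWeight_nonneg a
  unfold fpChartWeight
  have hA : ballCutoff H r (edgeChart H a) * Real.exp (-(β * (boxWilson H (edgeChart H a) + landauPhi H (edgeChart H a)))) ≤
      1 * Real.exp (-(β * (1 - ε) * boxQuadForm H a)) := mul_le_mul h1 h2 (Real.exp_pos _).le zero_le_one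
  have hB := mul_le_mul_of_nonneg_right hA (abs_nonneg ((fpOperator H (edgeChart H a)).det))
  have hC := mul_le_mul hB h3 h3' (mul_nonneg (mul_nonneg zero_le_one (Real.exp_pos _).le) (abs_nonneg _))
  calc ballCutoff H r (edgeChart H a) * Real.exp (-(β * (boxWilson H (edgeChart H a) + landauPhi H (edgeChart H a)))) *
        |(fpOperator H (edgeChart H a)).det| * chartHaarWeight H a
      ≤ 1 * Real.exp (-(β * (1 - ε) * boxQuadForm H a)) * |(fpOperator H (edgeChart H a)).det| *
          (1 / (2 * Real.pi ^ 2)) ^ Fintype.card (LandauFree H) := hC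
    _ = |(fpOperator H (edgeChart H a)).det| * (1 / (2 * Real.pi ^ 2)) ^ Fintype.card (LandauFree H) *
          Real.exp (-(β * (1 - ε) * boxQuadForm H a)) := by ring

/-- **LOWER bound**: given the action sandwich on `smallField H t` with `0 ≤ t ≤ min(r, 1)`, `r ≠ 0`, for `β ≥ 0` and `a ∈ smallField H t`:
`|det F(U_a)| · ((2π²)⁻¹)^{n} · e^{−n(t²/3 + t⁴)} · e^{−β(1+ε)Q(a)} ≤ fpChartWeight β H r a` (`n = |LandauFree H|`). -/
theorem le_fpChartWeight_of_sandwich {β t ε r : ℝ} (hβ : 0 ≤ β) (hr : r ≠ 0) (ht0 : 0 ≤ t) (htr : t ≤ r) (ht1 : t ≤ 1)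
    (hsand : ∀ a : LandauFree H → E3, (∀ e, ‖a e‖ ≤ t) →
      |boxWilson H (edgeChart H a) + landauPhi H (edgeChart H a) - boxQuadForm H a| ≤ ε * boxQuadForm H a)
    {a : LandauFree H → E3} (ha : a ∈ smallField H t) :
    |(fpOperator H (edgeChart H a)).det| * ((1 / (2 * Real.pi ^ 2)) ^ Fintype.card (LandauFree H) *
        Real.exp (-(Fintype.card (LandauFree H) * (t ^ 2 / 3 + t ^ 4)))) * Real.exp (-(β * (1 + ε) * boxQuadForm H a)) ≤
      fpChartWeight β H r a := by
  have htπ : t ≤ Real.pi := ht1.trans (by linarith [Real.pi_gt_three])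
  have hχ : ballCutoff H r (edgeChart H a) = 1 := ballCutoff_edgeChart_eq_one hr ht0 htr htπ ha
  have hWΦ : boxWilson H (edgeChart H a) + landauPhi H (edgeChart H a) ≤ (1 + ε) * boxQuadForm H a := by
    have h := (abs_le.1 (hsand a ha)).2
    linarith
  have h2 : Real.exp (-(β * (1 + ε) * boxQuadForm H a)) ≤
      Real.exp (-(β * (boxWilson H (edgeChart H a) + landauPhi H (edgeChart H a)))) :=
    Real.exp_le_exp.2 (by nlinarith [mul_le_mul_of_nonneg_left hWΦ hβ])
  have h3 := ChartHaar.chartHaarWeight_ge_of_smallField ht1 ha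
  have hlo : 0 ≤ (1 / (2 * Real.pi ^ 2)) ^ Fintype.card (LandauFree H) *
      Real.exp (-(Fintype.card (LandauFree H) * (t ^ 2 / 3 + t ^ 4))) := by positivity
  unfold fpChartWeight
  rw [hχ, one_mul]
  calc |(fpOperator H (edgeChart H a)).det| * ((1 / (2 * Real.pi ^ 2)) ^ Fintype.card (LandauFree H) *
          Real.exp (-(Fintype.card (LandauFree H) * (t ^ 2 / 3 + t ^ 4)))) * Real.exp (-(β * (1 + ε) * boxQuadForm H a))
      = Real.exp (-(β * (1 + ε) * boxQuadForm H a)) * |(fpOperator H (edgeChart H a)).det| *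
          ((1 / (2 * Real.pi ^ 2)) ^ Fintype.card (LandauFree H) * Real.exp (-(Fintype.card (LandauFree H) * (t ^ 2 / 3 + t ^ 4)))) := by ring
    _ ≤ Real.exp (-(β * (boxWilson H (edgeChart H a) + landauPhi H (edgeChart H a)))) * |(fpOperator H (edgeChart H a)).det| *
          chartHaarWeight H a :=
        mul_le_mul (mul_le_mul_of_nonneg_right h2 (abs_nonneg _)) h3 hlo (mul_nonneg (Real.exp_pos _).le (abs_nonneg _))

end FPChart

end Summit.QuantumFields.YangMills.Theorems.AllWindowsColdBoxBoxHighLine
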